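import Literature.IUT.HodgeArakelov.MonoThetaCyclotomes
import Literature.IUT.HodgeArakelov.MonoThetaFromGroups
import Literature.IUT.HodgeTheaters.Labels
import Literature.AnabelianGeometry.AbsoluteAnabelian.ProfiniteTerminology
import Mathlib.GroupTheory.Commensurable
import Mathlib.Combinatorics.SimpleGraph.Circulant
import Mathlib.Combinatorics.SimpleGraph.DeleteEdges
import Mathlib.Combinatorics.SimpleGraph.Subgraph
import Mathlib.Combinatorics.SimpleGraph.Acyclic
import Mathlib.Data.ZMod.ValMinAbs

/-!
# [IUTchII] §2, Proposition 2.1 – Remark 2.2.1: tempered coverings, dual graphs, decomposition groups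

Mochizuki, *Inter-universal Teichmüller theory II*, §2 "Galois-theoretic Theta Evaluation", kurims
manuscript (Dec. 2020) pp. 64–67: Proposition 2.1, Remark 2.1.1 (i), (ii), Proposition 2.2 (i), (ii),
Remark 2.2.1 [claim: Mochizuki2012, status: disputed] (IUTchII §2 Prop 2.1 - Rmk 2.2.1, kurims pp.64-67).
Record-only typing under the claim key `Mochizuki2012` (D-0012, disputed); definitions and `Prop`-valued
statements only.

§2 works "with the local portion at `v ∈ V^bad`" of the [IUTchI] objects; the local data at such `v` has
exactly the shape of the §1 setting (`k = K_v`, `X̲̲_k = X̲̲_v`, `Π_v = Π^tp_{X̲̲_v}`), extended by reference data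
for the plain curve `X_v` and the coverings of Prop. 2.1 — `BadPlaceSetting` (INTERFACE; TODO-merge:
abc-iut-L5-t2 [IUTchI] Def. 3.1 (e), Ex. 3.2 (ii); abc-iut-L2-t1/t2 [EtTh] §1–2).
* `IUTchII:Prop2.1` — the diagram of open injections `Π^tp_{Ÿ̲_v} → Π^tp_{Y̲_v} → Π^tp_{X̲̲_v} = Π_v` over
  `Π^tp_{Ÿ_v} → Π^tp_{Y_v} → Π^tp_{X_v}` with cartesian squares, "reconstructed via a functorial
  group-theoretic algorithm from the [temp-slim!] topological group `Π^tp_{X̲̲_v}`" — `TemperedCoverings`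
  (cartesian squares = intersections, DEFINED; existence = owners' construction).
* `IUTchII:Rmk2.1.1(i)`/`(ii)` — the dual graphs: `Γ_Ÿ` a chain of projective lines indexed by a
  `ℤ`-torsor, `Γ_X` a loop with vertices labelled `{-l⋇, …, 0, …, l⋇}`, the subgraphs `Γ▶_X ⊆ Γ_X` ("obtained
  from `Γ_X` by eliminating the unique edge joining the vertices with labels `±l⋇`") and `Γ•_X` (the vertex
  `0`), the inversion `ι` (negation of labels) — all DEFINED as Mathlib `SimpleGraph`s (`chainGraph`,
  `loopGraph`, `triGraph`, `bulletVerts`, `labelNeg`); the printed claims (vertex bijections; `Γ▶_X` the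
  unique `ι`-stable spanning tree) as named `Prop`s, with the bijection `{-l⋇,…,l⋇} ≅ ℤ/lℤ` PROVED.
* `IUTchII:Prop2.2(i)`/`(ii)` — the decomposition groups `Π_{v•} ⊆ Π_{v▶} ⊆ Π_v` of `Γ•_X`, `Γ▶_X` ([IUTchI]
  Cor. 2.3 (iii)), `ι`-stable representatives, reconstructibility (i), and the `ι`-invariant `μ_{2l}`-
  (resp. `μ`-) orbits `θ^ι(Π_v) ⊆ θ(Π_v)`, `∞θ^ι(Π_v) ⊆ ∞θ(Π_v)` (ii) — `SubgraphDecomposition` over the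
  Prop. 1.4 output (`EtaleThetaData`) + named facts.
* `IUTchII:Rmk2.2.1` — commensurable terminality of `Π_{v▶} ⊆ Π_v` ([IUTchI] Cor. 2.3 (iv)) ⇒ the
  conjugacy indeterminacy is inner: over the tree's `IsCommensurablyTerminal` ([AbsAnab] Def. 0.1 (iii), L4,
  imported) the statement is PROVED.
Underline caveat as in §1 (`X̲̲_v` double underline = type `(1,(ℤ/lℤ)^Θ)`; `Ÿ̲_v`, `Y̲_v` the [EtTh] coverings
over it; the plain `X_v`, `Y_v`, `Ÿ_v`).
-/

namespace Literature.IUT.HodgeArakelov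

open Literature.IUT.HodgeTheaters (lStar)
open Literature.AnabelianGeometry.AbsoluteAnabelian (IsCommensurablyTerminal)
open scoped Pointwise

universe u

/-! ## The local setting at `v ∈ V^bad` -/

/-- **IUTchII:Prop2.1** reference data (kurims p. 64) — INTERFACE extending the §1 setting at
`k = K_v`, `X̲̲_k = X̲̲_v`: "(a) `Π^tp_{X_v}`, `Π^tp_{X̲̲_v}` are the tempered fundamental groups determined by the
hyperbolic [orbi]curves `X̲̲_v`, `X_v` of [IUTchI], Definition 3.1, (e); (b) `Π^tp_{Y̲_v} ⊆ Π^tp_{X̲̲_v}`,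
`Π^tp_{Y_v} ⊆ Π^tp_{X_v}` are the open subgroups corresponding to the tempered coverings … determined by the
objects `Y̲^log`, `Y^log` in the discussion preceding [EtTh], Definition 2.7; (c) `Π^tp_{Ÿ̲_v} ⊆ Π^tp_{X̲̲_v}`
is the open subgroup determined by the tempered covering `Ÿ̲_v → X̲̲_v` of [IUTchI], Example 3.2, (ii);
`Π^tp_{Ÿ_v} ⊆ Π^tp_{X_v}` … determined by the object `Ÿ^log` in the discussion preceding [EtTh], Lemma 1.2".
TODO-merge:abc-iut-L5-t2 ([IUTchI] Def. 3.1 (e), Ex. 3.2 (ii)), abc-iut-L2-t1/t2 ([EtTh]).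
[claim: Mochizuki2012, status: disputed] (IUTchII §2 Prop 2.1, kurims p.64) -/
structure BadPlaceSetting : Type (u + 1) extends ThetaSetting.{u} where
  /-- `Π^tp_{X_v}` (plain `X_v`) -/
  PiXplain : TopGroup.{u}
  /-- the open injection `Π_v = Π^tp_{X̲̲_v} ↪ Π^tp_{X_v}` -/
  inclPlain : PiX →* PiXplain
  inclPlain_isOpenEmbedding : Topology.IsOpenEmbedding inclPlain
  /-- `Π^tp_{Ÿ_v} ⊆ Π^tp_{Y_v} ⊆ Π^tp_{X_v}` -/
  refY : Subgroup PiXplain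
  refYdd : Subgroup PiXplain
  refYdd_le : refYdd ≤ refY
  isOpen_refY : IsOpen (refY : Set PiXplain)
  isOpen_refYdd : IsOpen (refYdd : Set PiXplain)

/-! ## Proposition 2.1: the diagram of tempered coverings -/

/-- **IUTchII:Prop2.1** (kurims pp. 64–65) "(Review of Certain Tempered Coverings)", OUTPUT over a
topological group `P ≅ Π^tp_{X̲̲_v}`: the diagram of open injections
`Π^tp_{Ÿ̲_v} → Π^tp_{Y̲_v} → Π^tp_{X̲̲_v} = Π_v` (top row) over `Π^tp_{Ÿ_v} → Π^tp_{Y_v} → Π^tp_{X_v}` (bottom row),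
"(d) the arrows are the natural inclusions, and both squares are cartesian". Typed: the bottom row as a
topological group with two open subgroups, the vertical open injection, and the top row DEFINED as the
pull-backs (cartesian squares of injections are intersections); "corresponding to" = transported to the
reference data by some isomorphism compatible with the reference injection.
[claim: Mochizuki2012, status: disputed] (IUTchII §2 Prop 2.1, kurims pp.64-65) -/
structure TemperedCoverings (S : BadPlaceSetting.{u}) (P : TopGroup.{u}) : Type (u + 1) where
  isoRef : Nonempty (P ≃ₜ* S.PiX)
  /-- `Π^tp_{X_v}(P)` -/
  Xplain : TopGroup.{u}
  incl : P →* Xplain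
  incl_isOpenEmbedding : Topology.IsOpenEmbedding incl
  /-- `Π^tp_{Y_v} ⊆ Π^tp_{X_v}` and `Π^tp_{Ÿ_v} ⊆ Π^tp_{Y_v}` -/
  Y : Subgroup Xplain
  Ydd : Subgroup Xplain
  Ydd_le : Ydd ≤ Y
  isOpen_Y : IsOpen (Y : Set Xplain)
  isOpen_Ydd : IsOpen (Ydd : Set Xplain)
  /-- "reconstructed … from `Π^tp_{X̲̲_v}`": identified with the reference diagram along an isomorphism -/
  corresponds : ∃ (e : P ≃ₜ* S.PiX) (e' : Xplain ≃ₜ* S.PiXplain),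
    (∀ x, e' (incl x) = S.inclPlain (e x)) ∧
    Y.map e'.toMulEquiv.toMonoidHom = S.refY ∧ Ydd.map e'.toMulEquiv.toMonoidHom = S.refYdd

namespace TemperedCoverings

variable {S : BadPlaceSetting.{u}} {P : TopGroup.{u}} (T : TemperedCoverings S P)

/-- **IUTchII:Prop2.1** (d): `Π^tp_{Y̲_v} := Π_v ×_{Π^tp_{X_v}} Π^tp_{Y_v}` (cartesian square, DEFINED as the
pull-back). [claim: Mochizuki2012, status: disputed] (IUTchII §2 Prop 2.1, kurims p.65) -/
abbrev YL : Subgroup P := T.Y.comap T.incl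

/-- **IUTchII:Prop2.1** (d): `Π^tp_{Ÿ̲_v} := Π_v ×_{Π^tp_{X_v}} Π^tp_{Ÿ_v}` (DEFINED).
[claim: Mochizuki2012, status: disputed] (IUTchII §2 Prop 2.1, kurims p.65) -/
abbrev YddL : Subgroup P := T.Ydd.comap T.incl

/-- PROVED: the top-row inclusion `Π^tp_{Ÿ̲_v} ⊆ Π^tp_{Y̲_v}`. [claim: Mochizuki2012, status: disputed] (IUTchII §2 Prop 2.1, kurims p.65) -/
theorem YddL_le_YL : T.YddL ≤ T.YL := Subgroup.comap_mono T.Ydd_le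

end TemperedCoverings

/-! **Existence clause** of Prop. 2.1 ("there exists a functorial group-theoretic algorithm …"): NOT typed as a named
fact (reviews of `MonoThetaCyclotomes`: over an axiom-free interface the transport form is trivially provable and
the unguarded form is false for junk settings). The existence content is the owners' construction of the output
below for the genuine reference group ([EtTh] Prop. 2.4 / [IUTchI] Ex. 3.2, abc-iut-L2-t2 / abc-iut-L5-t2); functoriality = transport of the output structure along `≃ₜ*`. -/

/-! ## Remark 2.1.1: dual graphs -/

/-- **IUTchII:Rmk2.1.1(i)** (kurims p. 65): "the special fiber of any model of `Ÿ_v` that arises from a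
stable model of `X_v` consists of a chain of copies of the projective line joined together at the points `0`,
`∞` … The set of irreducible components of this special fiber may be thought of as a torsor over the group
`ℤ`." The dual graph `Γ_Ÿ` DEFINED as the chain graph on `ℤ` (vertices `n`, edges `{n, n+1}`); the same
graph serves for `Γ_Y`, `Γ_Ÿ̲`, `Γ_Y̲` ("each of the maps … induces a bijection on vertices").
[claim: Mochizuki2012, status: disputed] (IUTchII §2 Rmk 2.1.1 (i), kurims p.65) -/
def chainGraph : SimpleGraph ℤ := SimpleGraph.circulantGraph {1}

/-- **IUTchII:Rmk2.1.1(ii)** (kurims p. 65): the dual graph `Γ_X` (of `X̲̲_v`), a loop whose vertices are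
"labeled by elements `∈ {-l⋇, -l⋇+1, …, -1, 0, 1, …, l⋇-1, l⋇}` — where the vertex labeled `0` is fixed by
`ι_X`", i.e. by `ℤ/lℤ` (`l = 2l⋇ + 1`), consecutive labels joined (DEFINED; "the degree `l` covering … is
totally ramified at the cusps", `Γ_X̲̲ → Γ_X` a bijection on vertices). [claim: Mochizuki2012, status: disputed] (IUTchII §2 Rmk 2.1.1 (ii), kurims p.65) -/
def loopGraph (l : ℕ) : SimpleGraph (ZMod l) := SimpleGraph.circulantGraph {1}

/-- The covering map `Γ_Ÿ → Γ_X` on vertices, `n ↦ n mod l` (DEFINED). [claim: Mochizuki2012, status: disputed] (IUTchII §2 Rmk 2.1.1 (i), kurims p.65) -/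
def chainToLoop (l : ℕ) : ℤ → ZMod l := fun n => (n : ZMod l)

/-! `l⋇ := (l-1)/2` is the tree's `Literature.IUT.HodgeTheaters.lStar` ([IUTchI], abc-iut-L5-t4; imported). -/

/-- **IUTchII:Rmk2.1.1(ii)**: the inversion `ι_X` on labels, `j ↦ -j` ("the vertex labeled `0` is fixed by
`ι_X`") (DEFINED). [claim: Mochizuki2012, status: disputed] (IUTchII §2 Rmk 2.1.1 (ii), kurims p.65) -/
def labelNeg (l : ℕ) : ZMod l → ZMod l := fun j => -j

/-- **IUTchII:Rmk2.1.1(ii)** (kurims p. 65): `Γ▶_X ⊆ Γ_X`, "obtained from `Γ_X` by eliminating the unique edge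
joining the vertices with labels `±l⋇`" (DEFINED). [claim: Mochizuki2012, status: disputed] (IUTchII §2 Rmk 2.1.1 (ii), kurims p.65) -/
def triGraph (l : ℕ) : SimpleGraph (ZMod l) :=
  (loopGraph l).deleteEdges {s((lStar l : ZMod l), -(lStar l : ZMod l))}

/-- **IUTchII:Rmk2.1.1(ii)** (kurims p. 65): `Γ•_X ⊆ Γ▶_X` "consists of the unique vertex `0` and no edges"
(its vertex set, DEFINED). [claim: Mochizuki2012, status: disputed] (IUTchII §2 Rmk 2.1.1 (ii), kurims p.65) -/
def bulletVerts (l : ℕ) : Set (ZMod l) := {0}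

/-- **IUTchII:Rmk2.1.1(ii)**: `Γ▶_Ÿ ⊆ Γ_Ÿ`, the connected component over `Γ▶_X` containing `0` — the labels
`{-l⋇, …, l⋇} ⊆ ℤ` (its vertex set, DEFINED). [claim: Mochizuki2012, status: disputed] (IUTchII §2 Rmk 2.1.1 (ii), kurims p.66) -/
def triVertsZ (l : ℕ) : Set ℤ := Set.Icc (-(lStar l : ℤ)) (lStar l)

/-- **IUTchII:Rmk2.1.1(ii)** (kurims p. 66), PROVED: "the set of vertices of each subgraph `Γ▶_{(-)}` maps
bijectively to the set of vertices of `Γ▶_X`" — the labels `{-l⋇, …, l⋇}` map bijectively onto `ℤ/lℤ` for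
odd `l = 2l⋇+1`. [claim: Mochizuki2012, status: disputed] (IUTchII §2 Rmk 2.1.1 (ii), kurims p.66) -/
theorem triVertsZ_bijOn (l : ℕ) [NeZero l] (hl : Odd l) :
    Set.BijOn (chainToLoop l) (triVertsZ l) Set.univ := by
  have hls : l / 2 = lStar l := by
    obtain ⟨m, rfl⟩ := hl
    simp only [lStar]
    omega
  refine ⟨fun _ _ => Set.mem_univ _, ?_, ?_⟩
  · intro a ha b hb hab
    simp only [triVertsZ, Set.mem_Icc] at ha hb
    have key : ∀ x : ℤ, -(lStar l : ℤ) ≤ x → x ≤ lStar l → ((x : ZMod l)).valMinAbs = x := by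
      intro x hx1 hx2
      rcases le_or_gt 0 x with h0 | h0
      · lift x to ℕ using h0
        rw [Int.cast_natCast, ZMod.valMinAbs_natCast_of_le_half (by omega)]
      · have hx' : ((-x).toNat : ℤ) = -x := Int.toNat_of_nonneg (by omega)
        have h2 : (-x).toNat ≤ l / 2 := by omega
        have := ZMod.valMinAbs_natCast_of_le_half (n := l) h2
        rw [show ((-x).toNat : ZMod l) = -(x : ZMod l) by rw [← Int.cast_natCast, hx']; push_cast; ring]
          at this
        have hneg := ZMod.valMinAbs_neg_of_ne_half (a := (x : ZMod l)) ?_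
        · rw [hneg] at this; omega
        · intro hh
          -- `2 * a.val = l` is impossible for odd `l`
          obtain ⟨m, hm⟩ := hl
          omega
    have := congrArg ZMod.valMinAbs hab
    simp only [chainToLoop] at this
    rwa [key a ha.1 ha.2, key b hb.1 hb.2] at this
  · intro y _
    refine ⟨y.valMinAbs, ?_, ZMod.coe_valMinAbs y⟩
    simp only [triVertsZ, Set.mem_Icc]
    have h1 := ZMod.natAbs_valMinAbs_le y
    constructor <;> omega

/-- **IUTchII:Rmk2.1.1(ii)** (kurims p. 65), named claims: "`Γ▶_X ⊆ Γ_X` [is] the unique connected subgraph of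
`Γ_X` which is a tree that is stabilized by `ι_X` and contains every vertex of `Γ_X`; `Γ•_X ⊆ Γ▶_X` [is] the
unique connected subgraph of `Γ_X` stabilized by `ι_X` that contains precisely one vertex and no edges", for
an odd prime `l`. Named `Prop` (graph-theoretic; not discharged here).
[claim: Mochizuki2012, status: disputed] (IUTchII §2 Rmk 2.1.1 (ii), kurims p.65) -/
def Rmk211_ii_uniqueness (l : ℕ) : Prop :=
  (triGraph l).IsTree ∧ (triGraph l).map (Equiv.neg (ZMod l)).toEmbedding = triGraph l ∧
  (∀ H : SimpleGraph (ZMod l), H ≤ loopGraph l → H.IsTree →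
      H.map (Equiv.neg (ZMod l)).toEmbedding = H → H = triGraph l) ∧
  (∀ j : ZMod l, labelNeg l j = j ↔ j ∈ bulletVerts l)

/-- **IUTchII:Rmk2.1.1(ii)**, PROVED part: "the vertex labeled `0` is fixed by `ι_X`" and it is the ONLY fixed
label for odd `l` (so `Γ•_X` is the unique `ι`-stable one-vertex subgraph).
[claim: Mochizuki2012, status: disputed] (IUTchII §2 Rmk 2.1.1 (ii), kurims p.65) -/
theorem labelNeg_eq_self_iff (l : ℕ) [NeZero l] (hl : Odd l) (j : ZMod l) :
    labelNeg l j = j ↔ j ∈ bulletVerts l := by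
  simp only [labelNeg, bulletVerts, Set.mem_singleton_iff]
  rw [ZMod.neg_eq_self_iff]
  constructor
  · rintro (h | h)
    · exact h
    · exfalso
      obtain ⟨m, hm⟩ := hl
      omega
  · exact fun h => Or.inl h

/-- **IUTchII:Rmk2.1.1(ii)**, PROVED part: `Γ▶_X` "is stabilized by `ι_X`" — negation of labels is a graph
automorphism of the loop `Γ_X` preserving the deleted edge `{l⋇, -l⋇}`, hence maps `Γ▶_X` onto itself.
[claim: Mochizuki2012, status: disputed] (IUTchII §2 Rmk 2.1.1 (ii), kurims p.65) -/
theorem triGraph_adj_neg (l : ℕ) (a b : ZMod l) : (triGraph l).Adj (-a) (-b) ↔ (triGraph l).Adj a b := by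
  simp only [triGraph, loopGraph, SimpleGraph.deleteEdges_adj, SimpleGraph.circulantGraph_adj,
    Set.mem_singleton_iff, neg_sub_neg, neg_inj, Sym2.eq, Sym2.rel_iff', Prod.mk.injEq, Prod.swap_prod_mk]
  constructor
  · rintro ⟨⟨hne, h⟩, hedge⟩
    refine ⟨⟨hne, h.symm⟩, ?_⟩
    rintro (⟨rfl, rfl⟩ | ⟨rfl, rfl⟩)
    · exact hedge (Or.inr ⟨by simp, by simp⟩)
    · exact hedge (Or.inl ⟨by simp, by simp⟩)
  · rintro ⟨⟨hne, h⟩, hedge⟩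
    refine ⟨⟨hne, h.symm⟩, ?_⟩
    rintro (⟨ha, hb⟩ | ⟨ha, hb⟩)
    · exact hedge (Or.inr ⟨neg_eq_iff_eq_neg.mp ha, hb⟩)
    · exact hedge (Or.inl ⟨ha, neg_eq_iff_eq_neg.mp hb⟩)

/-- **IUTchII:Rmk2.1.1(ii)**, PROVED part (second conjunct of `Rmk211_ii_uniqueness`): `Γ▶_X` is stabilized
by `ι_X`, as an equality of graphs under the relabelling `j ↦ -j`.
[claim: Mochizuki2012, status: disputed] (IUTchII §2 Rmk 2.1.1 (ii), kurims p.65) -/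
theorem triGraph_map_neg (l : ℕ) :
    (triGraph l).map (Equiv.neg (ZMod l)).toEmbedding = triGraph l := by
  ext u v
  rw [SimpleGraph.map_adj]
  constructor
  · rintro ⟨a, b, hab, rfl, rfl⟩
    exact (triGraph_adj_neg l a b).mpr hab
  · intro h
    exact ⟨-u, -v, (triGraph_adj_neg l u v).mpr h, neg_neg u, neg_neg v⟩

/-! ## Proposition 2.2: decomposition groups of the subgraphs -/

/-- **IUTchII:Prop2.2** (kurims p. 66), OUTPUT over `Π_v ≅ Π^tp_{X̲̲_v}` with its Prop. 2.1 and Prop. 1.4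
outputs: "`Π_{v•} ⊆ Π_{v▶} ⊆ Π_v` for the decomposition groups determined, respectively, by the subgraphs
`Γ•_X` and `Γ▶_X` — i.e., … the group `Π^tp_{X,ℍ}` of [IUTchI], Corollary 2.3, (iii) … Thus, `Π_{v▶}` is
well-defined up to `Π_v`-conjugacy; once one fixes `Π_{v▶}`, then the subgroup `Π_{v•} ⊆ Π_{v▶}` is
well-defined up to `Π_{v▶}`-conjugacy …; `Π_{v▶} ⊆ Π^tp_{Y_v} ∩ Π_v = Π^tp_{Y̲_v}`. … we may assume that
`Π_{v•}`, `Π_{v▶}`, and `ι := ι_Ÿ` [cf. Remarks 1.4.1, (ii); 2.1.1, (ii)] have been chosen so that some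
representative of `ι` stabilizes `Π_{v•}` and `Π_{v▶}`." DATA: the two subgroups, a representative `ι` (an
automorphism of the topological group `Π_v`; cf. `PointedInversion` of Rmk. 1.4.1), and reference
decomposition groups `Π^tp_{X,ℍ}` ([IUTchI] Cor. 2.3 (iii) — interface datum, TODO-merge:abc-iut-L5-t1).
[claim: Mochizuki2012, status: disputed] (IUTchII §2 Prop 2.2, kurims p.66) -/
structure SubgraphDecomposition (S : BadPlaceSetting.{u}) {P : TopGroup.{u}} (T : TemperedCoverings S P)
    (D : EtaleThetaData S.toThetaSetting P) : Type (u + 1) where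
  /-- `Π_{v•} ⊆ Π_{v▶}` -/
  Pbullet : Subgroup P
  Ptri : Subgroup P
  bullet_le_tri : Pbullet ≤ Ptri
  /-- `Π_{v▶} ⊆ Π^tp_{Y̲_v}` -/
  tri_le_YL : Ptri ≤ T.YL
  /-- a representative of `ι = ι_Ÿ` stabilizing `Π_{v•}` and `Π_{v▶}` -/
  iota : P ≃ₜ* P
  iota_bullet : Pbullet.map iota.toMulEquiv.toMonoidHom = Pbullet
  iota_tri : Ptri.map iota.toMulEquiv.toMonoidHom = Ptri
  /-- `ι` restricts to `Π_Ÿ(Π_v)` (it is an automorphism of `Ÿ̲_v`) -/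
  iota_Ydd : D.PiYdd.map iota.toMulEquiv.toMonoidHom = D.PiYdd
  /-- reference decomposition groups `Π^tp_{X,Γ▶}`, `Π^tp_{X,Γ•}` in `Π^tp_{X̲̲_v}` ([IUTchI] Cor. 2.3 (iii)) -/
  refTri : Subgroup S.PiX
  refBullet : Subgroup S.PiX
  /-- "well-defined up to `Π_v`-conjugacy": some isomorphism with the reference carries `Π_{v▶}`, `Π_{v•}` to
  conjugates of the reference decomposition groups -/
  corresponds : ∃ (e : P ≃ₜ* S.PiX) (g : S.PiX),
    Ptri.map e.toMulEquiv.toMonoidHom = refTri.map (MulAut.conj g).toMonoidHom ∧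
    Pbullet.map e.toMulEquiv.toMonoidHom = refBullet.map (MulAut.conj g).toMonoidHom

/-- **IUTchII:Prop2.2(i)** (kurims p. 66): "The collection of data `(Π_{v•} ⊆ Π_{v▶} ⊆ Π_v, ι)`, regarded up
to `Π_v`-conjugacy, may be reconstructed via a functorial group-theoretic algorithm from the topological group
`Π_v`" (proof: dual graphs of stable models are group-theoretic, [SemiAnbd] Cor. 3.11 / [AbsTopI] Thm. 2.14
(i)). PREDICATE on the Prop. 2.1 / 1.4 outputs `(T, D)`. [claim: Mochizuki2012, status: disputed] (IUTchII §2 Prop 2.2 (i), kurims pp.66-67) -/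
def Prop22_i {S : BadPlaceSetting.{u}} {P : TopGroup.{u}} (T : TemperedCoverings S P)
    (D : EtaleThetaData S.toThetaSetting P) : Prop :=
  Nonempty (SubgraphDecomposition S T D)

/-- **IUTchII:Prop2.2(ii)** (kurims p. 66), OUTPUT: "The functorial group-theoretic algorithms
`Π_v ↦ θ(Π_v) ⊆ ∞θ(Π_v) ⊆ lim_J H¹(Π_Ÿ(Π_v)|_J, (l·Δ_Θ)(Π_v))` of Proposition 1.4 …, together with the
condition of invariance with respect to `ι` [cf. [EtTh], Proposition 1.4, (ii); the proof of [EtTh],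
Theorem 1.6, (iii)], determines a specific `μ_{2l}`- (respectively, `μ (= M^μ_TM(Π_v))`-) orbit
`θ^ι(Π_v) ⊆ θ(Π_v)` (respectively, `∞θ^ι(Π_v) ⊆ ∞θ(Π_v)`) within the unique `{(l·ℤ) × μ_{2l}}`- (respectively,
each `{(l·ℤ) × μ}`-) orbit contained in the set `θ(Π_v)` (respectively, `∞θ(Π_v)`)". DATA: the action of `ι`
on the cohomology (interface), and the subsets DEFINED as the `ι`-fixed classes; the printed orbit
properties as `Prop` fields. [claim: Mochizuki2012, status: disputed] (IUTchII §2 Prop 2.2 (ii), kurims p.66) -/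
structure IotaInvariantTheta {S : BadPlaceSetting.{u}} {P : TopGroup.{u}} {T : TemperedCoverings S P}
    {D : EtaleThetaData S.toThetaSetting P} (Dec : SubgraphDecomposition S T D) : Type (u + 1) where
  /-- the action of `ι` on `H¹(Π_Ÿ(Π_v), (l·Δ_Θ)(Π_v))` and on the direct limit -/
  iotaH1 : D.coh.H1 ⊤ ≃+ D.coh.H1 ⊤
  iotaLim : D.coh.lim ≃+ D.coh.lim
  iota_compat : ∀ x, D.coh.toLim ⊤ (iotaH1 x) = iotaLim (D.coh.toLim ⊤ x)
  /-- `ι` preserves `θ(Π_v)` and `∞θ(Π_v)` -/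
  iota_theta : iotaH1 '' D.theta = D.theta
  /-- `θ^ι(Π_v)` is a `μ_{2l}`-orbit: nonempty, and any two elements differ by a `2l`-torsion class -/
  thetaIota_nonempty : ∃ t ∈ D.theta, iotaH1 t = t
  thetaIota_orbit : ∀ t ∈ D.theta, ∀ t' ∈ D.theta, iotaH1 t = t → iotaH1 t' = t' →
    (2 * S.l) • (t' - t) = 0

namespace IotaInvariantTheta

variable {S : BadPlaceSetting.{u}} {P : TopGroup.{u}} {T : TemperedCoverings S P}
  {D : EtaleThetaData S.toThetaSetting P} {Dec : SubgraphDecomposition S T D} (Θ : IotaInvariantTheta Dec)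

/-- **IUTchII:Prop2.2(ii)**: `θ^ι(Π_v) ⊆ θ(Π_v)`, the `ι`-invariant classes (DEFINED).
[claim: Mochizuki2012, status: disputed] (IUTchII §2 Prop 2.2 (ii), kurims p.66) -/
def thetaIota : Set (D.coh.H1 ⊤) := {t ∈ D.theta | Θ.iotaH1 t = t}

/-- **IUTchII:Prop2.2(ii)**: `∞θ^ι(Π_v) ⊆ ∞θ(Π_v)`, the `ι`-invariant elements (DEFINED).
[claim: Mochizuki2012, status: disputed] (IUTchII §2 Prop 2.2 (ii), kurims p.66) -/
def thetaInftyIota : Set D.coh.lim := {x ∈ D.thetaInfty | Θ.iotaLim x = x}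

/-- PROVED (definitional): `θ^ι(Π_v) ⊆ θ(Π_v)` and `∞θ^ι(Π_v) ⊆ ∞θ(Π_v)`.
[claim: Mochizuki2012, status: disputed] (IUTchII §2 Prop 2.2 (ii), kurims p.66) -/
theorem thetaIota_subset : Θ.thetaIota ⊆ D.theta ∧ Θ.thetaInftyIota ⊆ D.thetaInfty :=
  ⟨fun _ h => h.1, fun _ h => h.1⟩

end IotaInvariantTheta

/-- **IUTchII:Prop2.2(ii)** existence (kurims pp. 66–67: "follows immediately from the results of [EtTh]").
PREDICATE on the Prop. 2.2 (i) output `Dec`. [claim: Mochizuki2012, status: disputed] (IUTchII §2 Prop 2.2 (ii), kurims pp.66-67) -/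
def Prop22_ii {S : BadPlaceSetting.{u}} {P : TopGroup.{u}} {T : TemperedCoverings S P}
    {D : EtaleThetaData S.toThetaSetting P} (Dec : SubgraphDecomposition S T D) : Prop :=
  Nonempty (IotaInvariantTheta Dec)

/-! ## Remark 2.2.1: commensurable terminality -/

/-- **IUTchII:Rmk2.2.1** (kurims p. 67): "since the subgroup `Π_{v▶} ⊆ Π_v` is commensurably terminal [cf.
[IUTchI], Corollary 2.3, (iv)], it follows that even when this subgroup is subject to a `Π_v`-conjugacy
indeterminacy, the indeterminacy induced on any specific `Π_v`-conjugate of this subgroup `Π_{v▶}` is an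
indeterminacy with respect to inner automorphisms". PROVED in the form: if `H` is commensurably terminal
([AbsAnab] Def. 0.1 (iii) — the tree's `Literature.AnabelianGeometry.AbsoluteAnabelian.IsCommensurablyTerminal`,
abc-iut-L4, imported) and `gHg⁻¹ = H`, then `g ∈ H`, so conjugation by `g` is inner on `H`. The
commensurable terminality itself is `Rmk221_commTerminal`.
[claim: Mochizuki2012, status: disputed] (IUTchII §2 Rmk 2.2.1, kurims p.67) -/
theorem Rmk221_inner {G : Type u} [Group G] (H : Subgroup G) (hH : IsCommensurablyTerminal H) (g : G)
    (hg : ConjAct.toConjAct g • H = H) : g ∈ H := by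
  rw [← hH.commensurator_eq, Subgroup.Commensurable.commensurator_mem_iff, hg]

/-- **IUTchII:Rmk2.2.1**, the input fact: `Π_{v▶} ⊆ Π_v` is commensurably terminal ([IUTchI] Cor. 2.3 (iv)).
PREDICATE on the Prop. 2.2 data `Dec`. [claim: Mochizuki2012, status: disputed] (IUTchII §2 Rmk 2.2.1, kurims p.67) -/
def Rmk221_commTerminal {S : BadPlaceSetting.{u}} {P : TopGroup.{u}} {T : TemperedCoverings S P}
    {D : EtaleThetaData S.toThetaSetting P} (Dec : SubgraphDecomposition S T D) : Prop :=
  IsCommensurablyTerminal Dec.Ptri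

end Literature.IUT.HodgeArakelov
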